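/-
Copyright (c) 2026. All rights reserved.
Released under Apache 2.0 license as described in the file LICENSE.
Authors: abc-iut cell, prover seat abc-iut-w5-d038 (gen 8; PROOF-ONLY: «punctures exhaust the cusps» —
hypothesis (FC) of the [AbsTopIII] Prop 4.2 (i) geometric column for the abstract Möbius deck group of a
uniformised punctured compact Riemann surface; row «FC-TOPOLOGICAL» (L4-lead m122), successor of
abc-iut-w6-d031's «FC-ROUTE»).
-/
import Literature.AnabelianGeometry.AbsoluteAnabelian.ArchimedeanHolFieldFunctorGeometricPSLCuspCompare
import HarnessLib

/-!
# Punctures exhaust the cusps, II: (FC) for the Möbius deck group of a punctured compact Riemann surface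

S. Mochizuki, *Topics in Absolute Anabelian Geometry III*, proof of Prop. 4.2 (i) (p. 106): at the
uniformised model `X = ℍ/Λ̄` of a hyperbolic Riemann surface of finite type the automorphism group
`N_{PSL₂(ℝ)}(Λ̄)/Λ̄` is FINITE.  In the tree this is abc-iut-L4-d1's
`HolRS.finiteIndex_subgroupOf_normalizer_of_cusps` (p460349) from (P) «a parabolic element» and (FC)
«finitely many `Λ̄`-classes of cusps»; abc-iut-w6-d031 proved (P) for the ABSTRACT Möbius deck group of
every uniformising `k : ℍ → M ∖ S` (p476737).  This file proves (FC) — classically «the cusps of the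
Fuchsian model of `M ∖ S` correspond to the punctures» (H. M. Farkas, I. Kra, *Riemann Surfaces* IV.6;
G. Shimura, *Introduction to the Arithmetic Theory of Automorphic Functions* §1.5) — for every COMPACT
Riemann surface `M` and finite `S`, by a Picard-free route (Shimizu's lemma + lifting):

* ★★ `HolRS.cuspClasses_finite` — **(FC) in abc-iut-L4-d1's binder shape** for the Möbius deck group of
  ANY holomorphic covering `k : ℍ → U = M ∖ S` acting freely and properly discontinuously: every
  eigenline of a parabolic lift is `Λ̄`-equivalent to one of `≤ |S|` lines.  The horoball of the cusp goes
  out to ONE puncture `s` (`HolRS.exists_tendsto_nhds_puncture`); the cusp is then `Λ̄`-conjugate to a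
  power `qⁿ` of the monodromy `q` of the chart end at `s` (`HolRS.exists_conj_zpow_of_tendsto`); two
  parabolic powers of `q` share their eigenline (`HolRS.exists_smul_eq_of_zpow`);
* `HolRS.cuspClasses_finite'` — the same with the free / properly discontinuous action DERIVED from the
  membership criterion (abc-iut-w6-d031's `exists_pslQuotient_iso_of_cover`);
* `HolRS.cuspClasses_finite_ofOpens_compl_finite`, ★ `HolRS.cuspClasses_finite_puncturedTorus` — the
  frames of abc-iut-w6-d031's (P) theorems: `M ∖ S`, and the once-punctured elliptic curve `E ∖ {x₀}`
  (IUT's `(1,1)` base), for EVERY uniformising `k`.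

With (P) (p476737) and (FC) (here), `finiteIndex_subgroupOf_normalizer_of_cusps(_of_le)` yield `hN` at
every finite-index `Λ̄′`, and abc-iut-w5-d096's `…_of_cuspClasses` assemblies (p479525/p480393) fire at
these bases.  PROOF-ONLY (no definition, no instance, no named fact); MODEL side of [AbsTopIII] §4
(model ≠ reconstruction); classical; nothing here bears on the disputed [IUTchIII] Cor. 3.12.

## References

* S. Mochizuki, *Topics in Absolute Anabelian Geometry III* (2015), proof of Prop. 4.2 (i) p.106.
  [MochizukiAbsTopIII2015]
* H. M. Farkas, I. Kra, *Riemann Surfaces*, 2nd ed. (1992), IV.5.5–IV.5.6, IV.6. [FarkasKra1992]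
* G. Shimura, *Introduction to the Arithmetic Theory of Automorphic Functions* (1971), §1.5. [Shimura1971]
-/

set_option autoImplicit false

noncomputable section

open Complex Filter Topology Metric Set Function
open scoped UpperHalfPlane MatrixGroups Matrix Manifold ContDiff Real
open _root_.TopologicalSpace (Opens)
open Literature.NumberTheory.Automorphic.Fuchsian (translSL)
open Literature.Geometry.Kaehler (ComplexTorus)

namespace Literature.AnabelianGeometry.AbsoluteAnabelian

namespace HolRS

/-! ### §2 (FC): finitely many `Λ̄`-classes of cusps -/

section Main

variable {M : Type} [TopologicalSpace M] [T2Space M] [CompactSpace M] [ChartedSpace ℂ M]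
  [IsManifold 𝓘(ℂ, ℂ) ω M]

/-- ★★ **(FC) «finitely many `Λ̄`-classes of cusps» for the Möbius deck group of a punctured compact
Riemann surface** — hypothesis (FC) of abc-iut-L4-d1's `HolRS.finiteIndex_subgroupOf_normalizer_of_cusps`
in its binder shape.  Let `M` be a COMPACT Riemann surface, `U ⊆ M` a connected open subset with FINITE
complement `S`, `k : ℍ → U` a holomorphic covering map whose Möbius deck group `Λ̄ ≤ PSL₂(ℝ)`
(membership criterion `k (q • τ) = k τ`) acts freely and properly discontinuously.  Then there is a
finite set `F ⊆ ℝ²` (one vector per puncture) such that every eigenvector `v` of every parabolic lift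
`t ∈ π⁻¹Λ̄` is moved by some lift `g ∈ π⁻¹Λ̄` into a line `ℝ w`, `w ∈ F`: the horoball of the cusp goes out
to a puncture `s` (`exists_tendsto_nhds_puncture`), so `π t` is `Λ̄`-conjugate to a power `qⁿ`, `n ≠ 0`,
of the monodromy of the chart end at `s` (`exists_conj_zpow_of_tendsto`), and two parabolic powers of
`q` share their eigenline (`exists_smul_eq_of_zpow`).
[cite: MochizukiAbsTopIII2015, Proposition 4.2 (i) proof p.106] [cite: FarkasKra1992, IV.5.5–IV.5.6]
[cite: Shimura1971, §1.5] -/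
theorem cuspClasses_finite (U : Opens M) (hU : IsConnected (U : Set M)) (hS : ((U : Set M)ᶜ).Finite)
    {k : ℍ → (ofOpens U hU).carrier} (hk : IsCoveringMap k) (dk : MDifferentiable 𝓘(ℂ, ℂ) 𝓘(ℂ, ℂ) k)
    (Λ : Subgroup PSL2R) [IsCancelSMul Λ ℍ] [ProperlyDiscontinuousSMul Λ ℍ]
    (hΛ : ∀ q : PSL2R, q ∈ Λ ↔ ∀ τ : ℍ, k (q • τ) = k τ) :
    ∃ F : Finset (Fin 2 → ℝ), ∀ t : SL(2, ℝ),
      (QuotientGroup.mk' (Subgroup.center SL(2, ℝ)) t : PSL2R) ∈ Λ →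
      (t : Matrix (Fin 2) (Fin 2) ℝ).IsParabolic →
      ∀ v : Fin 2 → ℝ, v ≠ 0 → (∃ c : ℝ, (t : Matrix (Fin 2) (Fin 2) ℝ) *ᵥ v = c • v) →
      ∃ g : SL(2, ℝ), (QuotientGroup.mk' (Subgroup.center SL(2, ℝ)) g : PSL2R) ∈ Λ ∧
        ∃ w ∈ F, ∃ c : ℝ, (g : Matrix (Fin 2) (Fin 2) ℝ) *ᵥ v = c • w := by
  classical
  let π' : SL(2, ℝ) →* PSL2R := QuotientGroup.mk' (Subgroup.center SL(2, ℝ))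
  -- §a fibre transitivity of `Λ̄` (deck transformations of a holomorphic `ℍ`-covering are Möbius)
  have hfib : ∀ τ τ' : ℍ, k τ = k τ' → ∃ q ∈ Λ, q • τ = τ' := by
    intro τ τ' h
    have hid : IsCoveringMap (fun x : (ofOpens U hU).carrier => x) := IsFiniteEtale.id.isCoveringMap
    obtain ⟨γ, hγ, hγτ⟩ :=
      UniformizedLift.exists_sl_lift (π₁ := k) (π₂ := k) (h := fun x : (ofOpens U hU).carrier => x)
        hk hk hid dk dk mdifferentiable_id (e₁ := τ) (e₂ := τ') h
    refine ⟨(QuotientGroup.mk γ : PSL2R), (hΛ _).2 fun σ => ?_, ?_⟩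
    · rw [psl_mk_smul]; exact hγ σ
    · rw [psl_mk_smul]; exact hγτ
  -- §b at each puncture: the chart end, its lift and its monodromy
  have hdata : ∀ s ∈ (U : Set M)ᶜ, ∃ (r : ℝ) (Gt : ℍ → ℍ) (Q : SL(2, ℝ)), 0 < r ∧ Continuous Gt ∧
      (π' Q : PSL2R) ∈ Λ ∧
      (∀ w : ℍ, (k (Gt w)).1 = (extChartAt 𝓘(ℂ, ℂ) s).symm
        (extChartAt 𝓘(ℂ, ℂ) s s + ((r / 2 : ℝ) : ℂ) * exp (2 * π * I * w))) ∧
      (∀ w w' : ℍ, (w' : ℂ) = w + 1 → Gt w' = (π' Q : PSL2R) • Gt w) := by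
    intro s hs
    have hpunct : ∃ V ∈ 𝓝 s, V \ {s} ⊆ (U : Set M) := by
      refine ⟨((U : Set M)ᶜ \ {s})ᶜ, ?_, fun y hy => ?_⟩
      · exact ((hS.subset fun z hz => hz.1).isClosed.isOpen_compl).mem_nhds fun h => h.2 rfl
      · by_contra hyU
        exact hy.1 ⟨hyU, hy.2⟩
    obtain ⟨r, G, hr, -, -, dG, hGper, hGval⟩ := exists_chartEnd U hU (s := s) hpunct
    obtain ⟨Gt, q, hq, dGt, hGtk, hGtdeck⟩ :=
      exists_lift_deck_of_periodic (ofOpens U hU) hk dk Λ hΛ dG hGper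
    obtain ⟨Q, hQ⟩ := QuotientGroup.mk_surjective q
    refine ⟨r, Gt, Q, hr, dGt.continuous, ?_, fun w => ?_, fun w w' hw => ?_⟩
    · rw [QuotientGroup.mk'_apply, hQ]; exact hq
    · rw [hGtk, hGval]
    · rw [QuotientGroup.mk'_apply, hQ]; exact hGtdeck w w' hw
  choose r Gt Q hr hGtc hQ hGlift hGdeck using hdata
  -- §c one vector per puncture: an eigenvector of a parabolic power of the monodromy, if any
  let wv : M → (Fin 2 → ℝ) := fun s =>
    if hs : s ∈ (U : Set M)ᶜ then
      (if hx : ∃ x : Fin 2 → ℝ, x ≠ 0 ∧ ∃ n : ℤ,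
          ((Q s hs ^ n : SL(2, ℝ)) : Matrix (Fin 2) (Fin 2) ℝ).IsParabolic ∧
          ∃ e : ℝ, ((Q s hs ^ n : SL(2, ℝ)) : Matrix (Fin 2) (Fin 2) ℝ) *ᵥ x = e • x
        then hx.choose else 0)
    else 0
  refine ⟨hS.toFinset.image wv, ?_⟩
  -- §d a cusp: straighten, push the horoball to a puncture, compare with the chart end
  rintro t ht hpar v hv ⟨c, hc⟩
  obtain ⟨A, h, hh, hAt⟩ := exists_psl_conj_translSL_eq hpar
  have hT : (π' (A * translSL h * A⁻¹) : PSL2R) ∈ Λ := by rw [hAt]; exact ht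
  obtain ⟨s, hs, hlim⟩ := exists_tendsto_nhds_puncture U hU hS hk Λ hfib A hh hT
  obtain ⟨μ, n, hμ, hrel⟩ := exists_conj_zpow_of_tendsto U hU hs hk dk Λ hΛ hfib (hr s hs) (hGtc s hs)
    (hQ s hs) (hGlift s hs) (hGdeck s hs) A ht hAt hlim
  -- matrices: `Qⁿ = M⁻¹ (± t) M`
  obtain ⟨Mm, hMm⟩ := QuotientGroup.mk_surjective μ
  have hrel' : (π' (t * Mm) : PSL2R) = π' (Mm * Q s hs ^ n) := by
    rw [map_mul, map_mul, map_zpow, QuotientGroup.mk'_apply, QuotientGroup.mk'_apply, hMm]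
    exact hrel
  rw [QuotientGroup.mk'_apply, QuotientGroup.mk'_apply, QuotientGroup.eq] at hrel'
  have hx : (((Mm⁻¹ : SL(2, ℝ)) : Matrix (Fin 2) (Fin 2) ℝ) *ᵥ v) ≠ 0 := sl_mulVec_ne_zero _ hv
  have hcase : ∃ e : ℝ, ((Q s hs ^ n : SL(2, ℝ)) : Matrix (Fin 2) (Fin 2) ℝ).IsParabolic ∧
      ((Q s hs ^ n : SL(2, ℝ)) : Matrix (Fin 2) (Fin 2) ℝ) *ᵥ
        (((Mm⁻¹ : SL(2, ℝ)) : Matrix (Fin 2) (Fin 2) ℝ) *ᵥ v) =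
        e • (((Mm⁻¹ : SL(2, ℝ)) : Matrix (Fin 2) (Fin 2) ℝ) *ᵥ v) := by
    rcases mem_center_sl_iff.mp hrel' with h1 | h1
    · -- `Mm Qⁿ = t Mm`
      have hMQ : Mm * Q s hs ^ n = t * Mm := by
        have h2 := congrArg (fun x => t * Mm * x) h1
        simpa only [mul_inv_cancel_left, mul_one] using h2
      have hQn : Q s hs ^ n = Mm⁻¹ * t * Mm⁻¹⁻¹ :=
        calc Q s hs ^ n = Mm⁻¹ * (Mm * Q s hs ^ n) := by group
          _ = Mm⁻¹ * (t * Mm) := by rw [hMQ]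
          _ = Mm⁻¹ * t * Mm⁻¹⁻¹ := by group
      refine ⟨c, ?_, ?_⟩
      · rw [hQn]; exact isParabolic_conj_sl _ _ hpar
      · rw [hQn, inv_inv, Matrix.mulVec_mulVec, ← Matrix.SpecialLinearGroup.coe_mul,
          mul_inv_cancel_right, Matrix.SpecialLinearGroup.coe_mul, ← Matrix.mulVec_mulVec, hc,
          Matrix.mulVec_smul]
    · -- `Mm Qⁿ = -(t Mm)`
      have hMQ : Mm * Q s hs ^ n = -(t * Mm) := by
        have h2 := congrArg (fun x => t * Mm * x) h1
        simpa only [mul_inv_cancel_left, mul_neg, mul_one] using h2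
      have hQn : Q s hs ^ n = Mm⁻¹ * (-t) * Mm⁻¹⁻¹ :=
        calc Q s hs ^ n = Mm⁻¹ * (Mm * Q s hs ^ n) := by group
          _ = Mm⁻¹ * (-(t * Mm)) := by rw [hMQ]
          _ = Mm⁻¹ * (-t) * Mm⁻¹⁻¹ := by rw [inv_inv, ← neg_mul, mul_assoc]
      refine ⟨-c, ?_, ?_⟩
      · rw [hQn]
        refine isParabolic_conj_sl _ _ ?_
        rw [Matrix.SpecialLinearGroup.coe_neg]
        exact hpar.neg
      · rw [hQn, inv_inv, Matrix.mulVec_mulVec, ← Matrix.SpecialLinearGroup.coe_mul,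
          mul_inv_cancel_right, Matrix.SpecialLinearGroup.coe_mul, Matrix.SpecialLinearGroup.coe_neg,
          ← Matrix.mulVec_mulVec, Matrix.neg_mulVec, hc, Matrix.mulVec_neg, Matrix.mulVec_smul,
          neg_smul]
  obtain ⟨e, hQnpar, hQnx⟩ := hcase
  -- §e the chosen vector at `s` spans the same line
  have hex : ∃ x : Fin 2 → ℝ, x ≠ 0 ∧ ∃ n : ℤ,
      ((Q s hs ^ n : SL(2, ℝ)) : Matrix (Fin 2) (Fin 2) ℝ).IsParabolic ∧
      ∃ e : ℝ, ((Q s hs ^ n : SL(2, ℝ)) : Matrix (Fin 2) (Fin 2) ℝ) *ᵥ x = e • x :=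
    ⟨_, hx, n, hQnpar, e, hQnx⟩
  have hwv : wv s = hex.choose := by
    simp only [wv, dif_pos hs, dif_pos hex]
  obtain ⟨hx₁, n₁, hpar₁, e₁, hQx₁⟩ := hex.choose_spec
  obtain ⟨c', hc'⟩ := exists_smul_eq_of_zpow (Q s hs) hx₁ hx hpar₁ hQnpar hQx₁ hQnx
  refine ⟨Mm⁻¹, ?_, wv s, Finset.mem_image_of_mem wv (hS.mem_toFinset.mpr hs), c', ?_⟩
  · rw [QuotientGroup.mk'_apply, QuotientGroup.mk_inv, hMm]
    exact Λ.inv_mem hμ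
  · rw [hwv]
    exact hc'

/-- `HolRS.cuspClasses_finite` with the free / properly discontinuous action DERIVED from the membership
criterion (abc-iut-w6-d031's `exists_pslQuotient_iso_of_cover`): (FC) for the Möbius deck group of ANY
holomorphic covering `k : ℍ → U`, `U` the complement of a finite set in a compact Riemann surface.
[cite: MochizukiAbsTopIII2015, Proposition 4.2 (i) proof p.106] [cite: FarkasKra1992, IV.5.5–IV.5.6] -/
theorem cuspClasses_finite' (U : Opens M) (hU : IsConnected (U : Set M)) (hS : ((U : Set M)ᶜ).Finite)
    {k : ℍ → (ofOpens U hU).carrier} (hk : IsCoveringMap k) (dk : MDifferentiable 𝓘(ℂ, ℂ) 𝓘(ℂ, ℂ) k)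
    (Λ : Subgroup PSL2R) (hΛ : ∀ q : PSL2R, q ∈ Λ ↔ ∀ τ : ℍ, k (q • τ) = k τ) :
    ∃ F : Finset (Fin 2 → ℝ), ∀ t : SL(2, ℝ),
      (QuotientGroup.mk' (Subgroup.center SL(2, ℝ)) t : PSL2R) ∈ Λ →
      (t : Matrix (Fin 2) (Fin 2) ℝ).IsParabolic →
      ∀ v : Fin 2 → ℝ, v ≠ 0 → (∃ c : ℝ, (t : Matrix (Fin 2) (Fin 2) ℝ) *ᵥ v = c • v) →
      ∃ g : SL(2, ℝ), (QuotientGroup.mk' (Subgroup.center SL(2, ℝ)) g : PSL2R) ∈ Λ ∧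
        ∃ w ∈ F, ∃ c : ℝ, (g : Matrix (Fin 2) (Fin 2) ℝ) *ᵥ v = c • w := by
  obtain ⟨Λ₁, hPD, hC, hΛ₁, -⟩ := exists_pslQuotient_iso_of_cover (ofOpens U hU) hk dk
  have hΛeq : Λ₁ = Λ := Subgroup.ext fun q => (hΛ₁ q).trans (hΛ q).symm
  subst hΛeq
  exact cuspClasses_finite U hU hS hk dk Λ₁ hΛ₁

/-- **(FC) at `M ∖ S`**, `S` finite with connected complement in a compact Riemann surface `M` — the
frame of abc-iut-w6-d031's `exists_parabolic_mem_of_cover_ofOpens_compl_finite` ((P), p476737): for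
EVERY holomorphic covering `k : ℍ → M ∖ S`, the Möbius deck group has finitely many cusp classes.
[cite: MochizukiAbsTopIII2015, Proposition 4.2 (i) proof p.106] [cite: FarkasKra1992, IV.5.5–IV.5.6] -/
theorem cuspClasses_finite_ofOpens_compl_finite {S : Set M} (hS : S.Finite)
    (hconn : IsConnected (Sᶜ : Set M))
    {k : ℍ → (ofOpens (⟨Sᶜ, hS.isClosed.isOpen_compl⟩ : Opens M) hconn).carrier}
    (hk : IsCoveringMap k) (dk : MDifferentiable 𝓘(ℂ, ℂ) 𝓘(ℂ, ℂ) k)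
    (Λ : Subgroup PSL2R) (hΛ : ∀ q : PSL2R, q ∈ Λ ↔ ∀ τ : ℍ, k (q • τ) = k τ) :
    ∃ F : Finset (Fin 2 → ℝ), ∀ t : SL(2, ℝ),
      (QuotientGroup.mk' (Subgroup.center SL(2, ℝ)) t : PSL2R) ∈ Λ →
      (t : Matrix (Fin 2) (Fin 2) ℝ).IsParabolic →
      ∀ v : Fin 2 → ℝ, v ≠ 0 → (∃ c : ℝ, (t : Matrix (Fin 2) (Fin 2) ℝ) *ᵥ v = c • v) →
      ∃ g : SL(2, ℝ), (QuotientGroup.mk' (Subgroup.center SL(2, ℝ)) g : PSL2R) ∈ Λ ∧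
        ∃ w ∈ F, ∃ c : ℝ, (g : Matrix (Fin 2) (Fin 2) ℝ) *ᵥ v = c • w :=
  cuspClasses_finite' _ hconn (by simpa using hS) hk dk Λ hΛ

end Main

/-- ★ **(FC) at the once-punctured elliptic curve `E ∖ {x₀}`** (`E = ℂ/Φ(ℤ²)`, IUT's `(1,1)` base; the
frame of abc-iut-w6-d031's `exists_parabolic_mem_of_cover_puncturedTorus`): for EVERY holomorphic
covering `k : ℍ → E ∖ {x₀}`, the Möbius deck group `Λ̄` has finitely many cusp classes — together with
(P) this is the full cusp datum of abc-iut-L4-d1's `finiteIndex_subgroupOf_normalizer_of_cusps` at the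
genuine curve. [cite: MochizukiAbsTopIII2015, Proposition 4.2 (i) proof p.106]
[cite: FarkasKra1992, IV.6] -/
theorem cuspClasses_finite_puncturedTorus (Φ : (Fin 2 → ℝ) ≃L[ℝ] ℂ) (x₀ : ComplexTorus Φ)
    {k : ℍ → (puncturedTorus Φ x₀).carrier} (hk : IsCoveringMap k)
    (dk : MDifferentiable 𝓘(ℂ, ℂ) 𝓘(ℂ, ℂ) k)
    (Λ : Subgroup PSL2R) (hΛ : ∀ q : PSL2R, q ∈ Λ ↔ ∀ τ : ℍ, k (q • τ) = k τ) :
    ∃ F : Finset (Fin 2 → ℝ), ∀ t : SL(2, ℝ),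
      (QuotientGroup.mk' (Subgroup.center SL(2, ℝ)) t : PSL2R) ∈ Λ →
      (t : Matrix (Fin 2) (Fin 2) ℝ).IsParabolic →
      ∀ v : Fin 2 → ℝ, v ≠ 0 → (∃ c : ℝ, (t : Matrix (Fin 2) (Fin 2) ℝ) *ᵥ v = c • v) →
      ∃ g : SL(2, ℝ), (QuotientGroup.mk' (Subgroup.center SL(2, ℝ)) g : PSL2R) ∈ Λ ∧
        ∃ w ∈ F, ∃ c : ℝ, (g : Matrix (Fin 2) (Fin 2) ℝ) *ᵥ v = c • w :=
  cuspClasses_finite' (M := ComplexTorus Φ) ⟨{x₀}ᶜ, isOpen_compl_singleton⟩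
    (isConnected_compl_singleton_complexTorus Φ x₀) (by simp) hk dk Λ hΛ

end HolRS

end Literature.AnabelianGeometry.AbsoluteAnabelian

end
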